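import Literature.AlgebraicGeometry.HodgeTheory.FermatAffineChart
import Literature.Geometry.ComplexAnalytic.PhamBrieskornJoinHomology
import Literature.AlgebraicTopology.SingularHomology.UniversalCoefficientsField
import Literature.AlgebraicTopology.SingularHomology.CohomologyHomotopyInvariance
import HarnessLib

/-!
# No class of positive degree on the affine Fermat variety is fixed by the rotations of one coordinate

Route `PadicSemiregularLift` of `HodgeConjecture`, crux `HodgeFermatVarieties`
(stmt-HodgeConjecture-1334: the Hodge conjecture for the complex Fermat hypersurfaces
`Xⁿₘ : Σ xᵢᵐ = 0 ⊂ ℙⁿ⁺¹`), line `cancel-by-any-claim-lattice`, stub `stub_eigenspaceStructure`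
(S5: Ran 1980 Prop. 1.7 / Shioda 1979 Thm. I on the real carriers — the structure of the
representation of `μₘ²ᵖ⁺²` on `H²ᵖ(X²ᵖₘ(ℂ); ℂ)`). This is the AFFINE LAYER of the stub, on which its
conjuncts (E2) (non-zero characters with a zero coordinate do not occur in `H²ᵖ`) and (E0) (the
invariants are restricted from `ℙ²ᵖ⁺¹`) rest (file `…StubEigenspaceStructure`). Everything here is
PROVED from the tree (no named fact, no hypothesis):

* `eigenspaceStructure_join_eq_zero_of_rotate` — on the join `J = Ω_{a₀} * ⋯ * Ω_{a_M}` (`M ≥ 1`)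
  **no non-zero class of `Hᵇ(J; ℂ)`, `b ≠ 0`, is fixed by all rotations of the last coordinate**:
  the dual, through universal coefficients over a field (`kroneckerPairing_injective_of_field`,
  `kroneckerPairing_map`) and averaging over the finite group `Ω_{a_M}`, of the tree's homological
  statement `PhamBrieskorn.eq_zero_of_forall_map_rotate_eq` (Milnor 1968 §9: "the eigenvalues of
  `r_{a*}` are the `a`-th roots of unity other than `1`") in the top degree, and of
  `PhamBrieskorn.isZero_singularHomology_join` in the others;
* `eigenspaceStructure_eq_zero_of_conj` — transport of this along any map `J → T` injective on
  `Hᵇ` and intertwining the rotations with self-maps of `T`;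
* `eigenspaceStructure_affine_eq_zero` — for the Fermat variety `Xⁿₘ` (`n, m ≥ 1`) and any
  coordinate `k`: **no non-zero class of `Hᵈ(U_k(ℂ); ℂ)`, `d ≠ 0`, `U_k = Xⁿₘ ∖ {x_k = 0}`, is fixed
  by the symmetries `(1, …, ζ, …, 1)`, `ζ ∈ μₘ` in the homogeneous slot `k.succAbove (last)`** —
  `U_k(ℂ)` is the Milnor fibre `{Σ zⱼᵐ = 1}` (`fermatFibreHomeomorph`, in which that symmetry is the
  rotation of the last affine coordinate, `fermatAffineChartFun_diagonalMapCompl`,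
  `chartFactor_single`), onto which the join deformation-retracts equivariantly (Pham's Lemma,
  `PhamBrieskorn.joinHomotopyEquivFibre`). This is the one-factor case of Pham's theorem "the
  character `(a₀, …, a_n)` of `μₘⁿ⁺¹` occurs in `H*(U; ℂ)` only if every `aⱼ ≠ 0`" that (E2) and
  (E0) need.

References: [Milnor1968] J. Milnor, Singular Points of Complex Hypersurfaces, Ann. of Math.
Studies 61 (1968), §9 Thm. 9.1, Lemma 9.2, p. 77; [Pham1965] F. Pham, Bull. Soc. Math. France 93
(1965) 333–367, §1; [Ran1980] Z. Ran, Cycles on Fermat hypersurfaces, Compositio Math. 42 (1980)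
121–142, §1 Lemma 1.4, (1.5), Prop. 1.7 (i); [HatcherAT2002] A. Hatcher, Algebraic Topology, CUP
2002, §3.1 Thm. 3.2 (universal coefficients over a field) and p. 201 (homotopy invariance).
-/

set_option linter.dupNamespace false

noncomputable section

open CategoryTheory AlgebraicGeometry Finset
open Literature.AlgebraicGeometry Literature.AlgebraicGeometry.Motives
open Literature.AlgebraicGeometry.HodgeTheory
open Literature.AlgebraicTopology.SingularHomology
open Literature.Geometry.ComplexAnalytic Literature.Geometry.ComplexAnalytic.PhamBrieskorn

namespace Summit.HodgeConjecture.HodgeConjecture.Theorems.CancelByAnyClaimLattice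

/-! ### The join `Ω * ⋯ * Ω`: no rotation-invariant cohomology in positive degree -/

section Join

variable {M : ℕ} {a : Fin (M + 1) → ℕ} (ha : ∀ i, a i ≠ 0)

/-- Two rotations of the last coordinate compose to the rotation by the product.
[cite: Milnor1968, §9 p. 77] -/
theorem eigenspaceStructure_rotate_comp_rotate (v w : Omega (a (Fin.last M))) :
    (rotate a ha v : C(join a, join a)).comp (rotate a ha w : C(join a, join a)) =
      (rotate a ha ⟨v * w, mul_mem_Omega v.2 w.2⟩ : C(join a, join a)) := by
  refine ContinuousMap.ext fun z ↦ Subtype.ext ?_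
  simp [ContinuousMap.comp_apply, rotateFun_rotateFun]

/-- The sum of the rotates `Σ_v (r_v)_* x` of a homology class is fixed by every rotation.
[cite: Milnor1968, §9 p. 77] -/
theorem eigenspaceStructure_map_rotate_sum [Fintype (Omega (a (Fin.last M)))] (b : ℕ)
    (x : singularHomology ℂ ℂ (join a) b) (w : Omega (a (Fin.last M))) :
    singularHomology.map ℂ ℂ (rotate a ha w : C(join a, join a)) b
        (∑ v, singularHomology.map ℂ ℂ (rotate a ha v : C(join a, join a)) b x) =
      ∑ v, singularHomology.map ℂ ℂ (rotate a ha v : C(join a, join a)) b x := by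
  rw [map_sum]
  have hterm : ∀ v : Omega (a (Fin.last M)),
      singularHomology.map ℂ ℂ (rotate a ha w : C(join a, join a)) b
          (singularHomology.map ℂ ℂ (rotate a ha v : C(join a, join a)) b x) =
        singularHomology.map ℂ ℂ (rotate a ha ⟨w * v, mul_mem_Omega w.2 v.2⟩ : C(join a, join a)) b x :=
    fun v ↦ by
      rw [← ModuleCat.comp_apply, ← singularHomology.map_comp, eigenspaceStructure_rotate_comp_rotate]
  simp_rw [hterm]
  have hw0 : (w : ℂ) ≠ 0 := ne_zero_of_mem_Omega (ha _) w.2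
  have hinj : Function.Injective fun v : Omega (a (Fin.last M)) ↦
      (⟨w * v, mul_mem_Omega w.2 v.2⟩ : Omega (a (Fin.last M))) := by
    intro v v' h
    have h' := congrArg Subtype.val h
    exact Subtype.ext (mul_left_cancel₀ hw0 h')
  exact Fintype.sum_bijective _ (Finite.injective_iff_bijective.mp hinj) _ _ fun v ↦ rfl

/-- **No non-zero cohomology class of positive degree on the join `J = Ω_{a₀} * ⋯ * Ω_{a_M}`
(`M ≥ 1`, field coefficients `ℂ`) is fixed by all rotations of the last coordinate.** In the top
degree `M` this is the dual (universal coefficients over a field, Kronecker injectivity) of Milnor's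
"the eigenvalues of `r_{a*}` on `H̃₀(Ω_a)` are the roots of unity other than `1`"
(`eq_zero_of_forall_map_rotate_eq`, averaging over the finite group `Ω_{a_M}`); in the other
positive degrees the homology vanishes (`isZero_singularHomology_join`).
[cite: Milnor1968, §9 Thm. 9.1 and p. 77] [cite: HatcherAT2002, §3.1 Thm. 3.2] -/
theorem eigenspaceStructure_join_eq_zero_of_rotate (hM : 1 ≤ M) {b : ℕ} (hb : b ≠ 0)
    (y : singularCohomology ℂ ℂ (join a) b)
    (hy : ∀ v : Omega (a (Fin.last M)),
      singularCohomology.map ℂ ℂ (rotate a ha v : C(join a, join a)) b y = y) :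
    y = 0 := by
  classical
  obtain ⟨N, rfl⟩ : ∃ N, M = N + 1 := ⟨M - 1, by omega⟩
  haveI : Fintype (Omega (a (Fin.last (N + 1)))) := (finite_Omega (ha _)).fintype
  haveI : Nonempty (Omega (a (Fin.last (N + 1)))) := ⟨⟨1, one_mem_Omega _⟩⟩
  apply kroneckerPairing_injective_of_field ℂ (join a) b
  rw [map_zero]
  refine LinearMap.ext fun x ↦ ?_
  rw [LinearMap.zero_apply]
  set s := ∑ v : Omega (a (Fin.last (N + 1))),
    singularHomology.map ℂ ℂ (rotate a ha v : C(join a, join a)) b x with hs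
  have hs0 : s = 0 := by
    by_cases hbn : b = N + 1
    · subst hbn
      exact eq_zero_of_forall_map_rotate_eq ℂ ha s fun w ↦ eigenspaceStructure_map_rotate_sum ha _ x w
    · exact eq_zero_of_isZero ℂ (isZero_singularHomology_join ℂ ha hb hbn) s
  have hpair : ∀ v : Omega (a (Fin.last (N + 1))),
      kroneckerPairing ℂ ℂ (join a) b y (singularHomology.map ℂ ℂ (rotate a ha v : C(join a, join a)) b x) =
        kroneckerPairing ℂ ℂ (join a) b y x := fun v ↦ by
    rw [← kroneckerPairing_map, hy v]
  have hsum : kroneckerPairing ℂ ℂ (join a) b y s =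
      (Fintype.card (Omega (a (Fin.last (N + 1)))) : ℂ) * kroneckerPairing ℂ ℂ (join a) b y x := by
    rw [hs, map_sum]
    simp_rw [hpair]
    rw [Finset.sum_const, Finset.card_univ, nsmul_eq_mul]
  rw [hs0, map_zero] at hsum
  have hcard : (Fintype.card (Omega (a (Fin.last (N + 1)))) : ℂ) ≠ 0 :=
    Nat.cast_ne_zero.mpr Fintype.card_ne_zero
  exact (mul_eq_zero.mp hsum.symm).resolve_left hcard

/-- **Transport along an equivariant map.** If `e : J → T` induces an injection on `Hᵇ(-; ℂ)`
(`b ≠ 0`, `M ≥ 1`) and intertwines the rotations `r_v` of the last coordinate of the join with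
self-maps `ρ_v` of `T` (`ρ_v ∘ e = e ∘ r_v`), then no non-zero class of `Hᵇ(T; ℂ)` is fixed by all
the `ρ_v^*`. [cite: Milnor1968, §9 Thm. 9.1 and p. 77] -/
theorem eigenspaceStructure_eq_zero_of_conj (hM : 1 ≤ M) {T : Type} [TopologicalSpace T]
    (e : C(join a, T)) {b : ℕ} (hb : b ≠ 0)
    (he : Function.Injective (singularCohomology.map ℂ ℂ e b))
    (ρ : Omega (a (Fin.last M)) → C(T, T))
    (hρ : ∀ v, (ρ v).comp e = e.comp (rotate a ha v : C(join a, join a)))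
    (y : singularCohomology ℂ ℂ T b) (hy : ∀ v, singularCohomology.map ℂ ℂ (ρ v) b y = y) : y = 0 := by
  apply he
  rw [map_zero]
  refine eigenspaceStructure_join_eq_zero_of_rotate ha hM hb _ fun v ↦ ?_
  rw [← ModuleCat.comp_apply, ← singularCohomology.map_comp, ← hρ v, singularCohomology.map_comp,
    ModuleCat.comp_apply, hy v]

end Join

/-! ### The affine piece `U_k(ℂ) = {x_k ≠ 0}` of the Fermat variety -/

section Affine

variable {n m : ℕ}

/-- `(1, …, 1, ζ)` written as an update and as a `snoc`. [folklore] -/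
theorem eigenspaceStructure_update_one_last (ζ : ℂ) :
    Function.update (fun _ : Fin (n + 1) ↦ (1 : ℂ)) (Fin.last n) ζ = Fin.snoc (fun _ : Fin n ↦ (1 : ℂ)) ζ := by
  funext i
  refine Fin.lastCases ?_ (fun j ↦ ?_) i
  · rw [Function.update_self, Fin.snoc_last]
  · rw [Function.update_of_ne (Fin.castSucc_lt_last j).ne, Fin.snoc_castSucc]

/-- **In the chart `U_k(ℂ) ≃ₜ {Σ zⱼᵐ = 1}` the symmetry `(1, …, ζ, …, 1)` (`ζ` in the homogeneous
slot `k.succAbove (last)`) is the rotation of the last affine coordinate by `ζ`.**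
[cite: Ran1980, §1 Lemma 1.4] [cite: Milnor1968, §9 p. 77] -/
theorem eigenspaceStructure_fermatFibreHomeomorph_diagonalMapCompl (hm : m ≠ 0) (k : Fin (n + 2))
    (ζ : rootsOfUnity m ℂ) (P : complexPointsCompl (SmoothHypersurface.hypersurface (fermatPolynomial ℂ n m)) (fermatCoordHyperplane n m k)) :
    (fermatFibreHomeomorph hm k (diagonalMapCompl k (fermatGroupSingle (k.succAbove (Fin.last n)) ζ) P) :
        Fin (n + 1) → ℂ) =
      rotateFun ((ζ : ℂˣ) : ℂ) (fermatFibreHomeomorph hm k P) := by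
  rw [fermatFibreHomeomorph_apply_coe, fermatFibreHomeomorph_apply_coe,
    fermatAffineChartFun_diagonalMapCompl, chartFactor_single, eigenspaceStructure_update_one_last,
    rotateFun, mul_smul_comm]

/-- **No non-zero class of `Hᵈ(U_k(ℂ); ℂ)`, `d ≠ 0`, is fixed by the symmetries `(1, …, ζ, …, 1)`,
`ζ ∈ μₘ` in the homogeneous slot `k.succAbove (last)`** (`Xⁿₘ`, `n ≥ 1`, `m ≥ 1`, any `k`): the
affine piece `U_k(ℂ) = {x_k ≠ 0}` is the Milnor fibre `{Σ zⱼᵐ = 1}` (`fermatFibreHomeomorph`), which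
deformation-retracts onto the join `μₘ * ⋯ * μₘ` (Pham; `joinHomotopyEquivFibre`) equivariantly,
and on the join the rotations of one factor have no invariants in positive degree
(`eigenspaceStructure_join_eq_zero_of_rotate`). This is the tree's form of "the character
`(a₀, …, a_n)` of `μₘⁿ⁺¹` occurs in `Hⁿ(U; ℂ)` only if all `aⱼ ≠ 0`" (Pham 1965; Milnor Thm. 9.1)
for the one factor that is needed. [cite: Milnor1968, §9 Thm. 9.1 and p. 77] [cite: Pham1965, §1]
[cite: Ran1980, §1 Lemma 1.4 and Prop. 1.7 (i)] -/
theorem eigenspaceStructure_affine_eq_zero_of (hn : 1 ≤ n) (hm : m ≠ 0) (k : Fin (n + 2)) {d : ℕ}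
    (hd : d ≠ 0) (x : singularCohomology ℂ ℂ (complexPointsCompl
      (SmoothHypersurface.hypersurface (fermatPolynomial ℂ n m)) (fermatCoordHyperplane n m k)) d)
    (hx : ∀ ζ : rootsOfUnity m ℂ, singularCohomology.map ℂ ℂ
      (diagonalMapCompl k (fermatGroupSingle (k.succAbove (Fin.last n)) ζ)) d x = x) :
    x = 0 := by
  haveI : NeZero m := ⟨hm⟩
  have ha : ∀ i : Fin (n + 1), (fun _ : Fin (n + 1) ↦ m) i ≠ 0 := fun _ ↦ hm
  set incl : C(join (fun _ : Fin (n + 1) ↦ m), fibre (fun _ : Fin (n + 1) ↦ m)) :=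
    ⟨Set.inclusion join_subset_fibre, continuous_inclusion join_subset_fibre⟩ with hincl_def
  -- `incl^*` and `(φ⁻¹)^*` are injective, `φ = fermatFibreHomeomorph`
  have hincl : Function.Injective (singularCohomology.map ℂ ℂ incl d) := by
    have h := ConcreteCategory.bijective_of_isIso
      (singularCohomology.isoOfHomotopyEquiv' ℂ ℂ (joinHomotopyEquivFibre (fun _ : Fin (n + 1) ↦ m) ha) d).hom
    rw [singularCohomology.isoOfHomotopyEquiv'_hom, joinHomotopyEquivFibre_toFun] at h
    exact h.1
  have hφ : Function.Injective (singularCohomology.map ℂ ℂ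
      ((fermatFibreHomeomorph hm k).symm :
        C(fibre (fun _ : Fin (n + 1) ↦ m), complexPointsCompl (SmoothHypersurface.hypersurface (fermatPolynomial ℂ n m)) (fermatCoordHyperplane n m k))) d) := by
    intro y y' h
    have h2 := congrArg (singularCohomology.map ℂ ℂ
      (fermatFibreHomeomorph hm k :
        C(complexPointsCompl (SmoothHypersurface.hypersurface (fermatPolynomial ℂ n m)) (fermatCoordHyperplane n m k), fibre (fun _ : Fin (n + 1) ↦ m))) d) h
    rwa [← ModuleCat.comp_apply, ← ModuleCat.comp_apply, ← singularCohomology.map_comp,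
      Homeomorph.symm_comp_toContinuousMap, singularCohomology.map_id] at h2
  refine eigenspaceStructure_eq_zero_of_conj ha hn
    (((fermatFibreHomeomorph hm k).symm :
      C(fibre (fun _ : Fin (n + 1) ↦ m), complexPointsCompl (SmoothHypersurface.hypersurface (fermatPolynomial ℂ n m)) (fermatCoordHyperplane n m k))).comp incl)
    hd (fun y y' h ↦ hφ (hincl ?_))
    (fun v ↦ diagonalMapCompl k (fermatGroupSingle (k.succAbove (Fin.last n))
      (rootsOfUnity.mkOfPowEq (v : ℂ) (mem_Omega.1 v.2))))
    (fun v ↦ ?_) x (fun v ↦ hx _)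
  · rwa [← ModuleCat.comp_apply, ← ModuleCat.comp_apply, ← singularCohomology.map_comp]
  · refine ContinuousMap.ext fun z ↦ ?_
    change diagonalMapCompl k (fermatGroupSingle (k.succAbove (Fin.last n))
        (rootsOfUnity.mkOfPowEq (v : ℂ) (mem_Omega.1 v.2))) ((fermatFibreHomeomorph hm k).symm (incl z)) =
      (fermatFibreHomeomorph hm k).symm (incl (rotate (fun _ : Fin (n + 1) ↦ m) ha v z))
    apply (fermatFibreHomeomorph hm k).injective
    refine Subtype.ext ?_
    rw [eigenspaceStructure_fermatFibreHomeomorph_diagonalMapCompl, Homeomorph.apply_symm_apply,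
      Homeomorph.apply_symm_apply, rootsOfUnity.val_mkOfPowEq_coe]
    rfl

end Affine

/-- **No non-zero class of `Hᵈ(U_k(ℂ); ℂ)`, `d ≠ 0`, `U_k = Xⁿₘ ∖ {x_k = 0}` (`n, m ≥ 1`, any `k`),
is fixed by all the symmetries `(1, …, ζ, …, 1)`, `ζ ∈ μₘ` in the homogeneous slot
`k.succAbove (last)`** — closed form of `eigenspaceStructure_affine_eq_zero_of` (Pham's theorem on
the affine Fermat variety, one factor: the Milnor fibre `{Σ zⱼᵐ = 1}` retracts equivariantly onto the
join `μₘ * ⋯ * μₘ`, on whose positive-degree cohomology the rotations of one factor have no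
invariants). [cite: Milnor1968, §9 Thm. 9.1 and p. 77] [cite: Pham1965, §1]
[cite: Ran1980, §1 Lemma 1.4 and Prop. 1.7 (i)] -/
theorem eigenspaceStructure_affine_eq_zero :
    ∀ {n m : ℕ}, 1 ≤ n → m ≠ 0 → ∀ (k : Fin (n + 2)) {d : ℕ}, d ≠ 0 →
      ∀ x : singularCohomology ℂ ℂ (complexPointsCompl
        (SmoothHypersurface.hypersurface (fermatPolynomial ℂ n m)) (fermatCoordHyperplane n m k)) d,
        (∀ ζ : rootsOfUnity m ℂ, singularCohomology.map ℂ ℂ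
          (diagonalMapCompl k (fermatGroupSingle (k.succAbove (Fin.last n)) ζ)) d x = x) → x = 0 :=
  fun hn hm k _ hd x hx ↦ eigenspaceStructure_affine_eq_zero_of hn hm k hd x hx

end Summit.HodgeConjecture.HodgeConjecture.Theorems.CancelByAnyClaimLattice

end
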